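import Mathlib.Analysis.Complex.Schwarz
import Mathlib.Analysis.Calculus.Deriv.Slope
import Mathlib.Analysis.Calculus.Deriv.Comp
import Mathlib.Analysis.SpecificLimits.Basic
import Mathlib.MeasureTheory.Integral.Bochner.Basic
import HarnessLib

/-!
# Holomorphic dependence of dominated parameter integrals (several complex variables)

Analysis/Complex support file (everything proved; no definitions, no named facts): the classical
theorem that an integral `∫ F(p, a) dμ(a)` depending holomorphically on a parameter `p` in a
complex normed space `P`, with a locally uniform integrable majorant, is holomorphic in `p` — in
the Fréchet sense `DifferentiableOn ℂ`, which on finite-dimensional `P` is joint holomorphy in all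
variables (and analyticity, `Literature.Analysis.Complex.SCV.analyticOnNhd_of_differentiableOn`).
The point of the file is that **no hypothesis on the derivative is needed** (neither a formula,
nor its measurability, nor a bound): the Cauchy–Schwarz-lemma estimates supply them.

* `norm_fderiv_le_of_forall_mem_ball_norm_le` — Cauchy's estimate `‖Df(c)‖ ≤ 2M/R` for `f`
  holomorphic and bounded by `M` on `ball c R` (Mathlib's Schwarz lemma
  `Complex.norm_fderiv_le_div_of_mapsTo_ball`);
* `norm_sub_sub_fderiv_le_of_forall_mem_ball_norm_le` — **the second-order Schwarz estimate**
  `‖f z - f c - Df(c)(z - c)‖ ≤ 4M (‖z - c‖/R)²` on `ball c R` (Mathlib's higher-order Schwarz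
  lemma `Complex.dist_le_mul_div_pow_of_mapsTo_ball_of_isLittleO` with `n = 1`, applied to
  `f - Df(c)(· - c)`);
* `aestronglyMeasurable_fderiv_apply` — `a ↦ D_p F(x₀, a) v` is a.e. strongly measurable: it is
  the a.e. limit of the measurable difference quotients `t⁻¹(F(x₀ + t v, a) - F(x₀, a))`,
  `t = tₙ ↓ 0`;
* `hasFDerivAt_integral_of_dominated_of_differentiableOn` — if `F(·, a)` is holomorphic on
  `ball x₀ R` for a.e. `a`, `F(p, ·)` is a.e. strongly measurable for `p ∈ ball x₀ R`, and
  `‖F(p, a)‖ ≤ bound(a)` there with `bound ∈ L¹`, then `p ↦ ∫ F(p, a) dμ` has at `x₀` the Fréchet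
  derivative `v ↦ ∫ D_pF(x₀, a) v dμ` (the remainder is `≤ 4‖bound‖₁ (‖h‖/R)²` by the second-order
  estimate under the integral sign);
* `differentiableOn_integral_of_dominated` — the `DifferentiableOn ℂ` form on an open set with
  local majorants.

(The statement "integrals of holomorphic families with an integrable majorant are holomorphic in
the parameters" is standard several-complex-variables folklore; the estimates are Cauchy's
inequalities, here in Mathlib's Schwarz-lemma form. Everything is tagged folklore.) Consumers:
the complexified Oseen scheme of `Literature/Analysis/FluidPDE/NSBoundedMildAnalytic.lean`
(Lemarié-Rieusset 2016, Thm. 9.12: space–time analyticity of bounded mild solutions).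

## Mathlib search

`hasFDerivAt_integral_of_dominated_of_fderiv_le`, `hasFDerivAt_integral_of_dominated_loc_of_lip`
(`Mathlib.Analysis.Calculus.ParametricIntegral`) require an a.e.-measurable derivative field
`F' : α → (P →L E)` and a bound for it; for holomorphic families both are consequences of the
sup bound, which is what this file packages. Schwarz lemmas: `Mathlib.Analysis.Complex.Schwarz`.
No Mathlib statement found for `norm_sub_sub_fderiv_le` (`lean search 'sub_sub_fderiv|schwarz'`).
-/

noncomputable section

open MeasureTheory Metric Set Filter Asymptotics
open _root_.Topology

namespace Literature.Analysis.Complex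

variable {P : Type*} [NormedAddCommGroup P] [NormedSpace ℂ P]
variable {G : Type*} [NormedAddCommGroup G] [NormedSpace ℂ G]

/-! ### Cauchy–Schwarz estimates of first and second order -/

section Schwarz

/-- **Cauchy's estimate for the derivative**: if `f` is holomorphic on `ball c R` and bounded by
`M` there, then `‖Df(c)‖ ≤ 2M/R` (`f` maps the ball into `closedBall (f c) (2M)`; Schwarz lemma).
[folklore] -/
theorem norm_fderiv_le_of_forall_mem_ball_norm_le {f : P → G} {c : P} {R M : ℝ} (hR : 0 < R)
    (hd : DifferentiableOn ℂ f (ball c R)) (hM : ∀ w ∈ ball c R, ‖f w‖ ≤ M) :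
    ‖fderiv ℂ f c‖ ≤ 2 * M / R := by
  have hmaps : MapsTo f (ball c R) (closedBall (f c) (2 * M)) := by
    intro w hw
    rw [mem_closedBall, dist_eq_norm]
    calc ‖f w - f c‖ ≤ ‖f w‖ + ‖f c‖ := norm_sub_le _ _
      _ ≤ M + M := add_le_add (hM w hw) (hM c (mem_ball_self hR))
      _ = 2 * M := by ring
  exact Complex.norm_fderiv_le_div_of_mapsTo_ball hd hmaps hR

/-- **Second-order Schwarz estimate** (Taylor remainder of a bounded holomorphic map): if `f` is
holomorphic on `ball c R` and bounded by `M` there, then for every `z ∈ ball c R`,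
`‖f z - f c - Df(c)(z - c)‖ ≤ 4M (‖z - c‖/R)²`. Proof: `ψ = f - Df(c)(· - c)` is holomorphic, maps
the ball into `closedBall (ψ c) (4M)` (Cauchy's estimate `‖Df(c)‖ ≤ 2M/R`) and satisfies
`ψ - ψ c = o(‖· - c‖)`, so Mathlib's Schwarz lemma of order `n = 1` applies. [folklore] -/
theorem norm_sub_sub_fderiv_le_of_forall_mem_ball_norm_le {f : P → G} {c z : P} {R M : ℝ}
    (hd : DifferentiableOn ℂ f (ball c R)) (hM : ∀ w ∈ ball c R, ‖f w‖ ≤ M) (hz : z ∈ ball c R) :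
    ‖f z - f c - fderiv ℂ f c (z - c)‖ ≤ 4 * M * (‖z - c‖ / R) ^ 2 := by
  have hR : 0 < R := nonempty_ball.mp ⟨_, hz⟩
  have hM0 : 0 ≤ M := (norm_nonneg _).trans (hM c (mem_ball_self hR))
  set L : P →L[ℂ] G := fderiv ℂ f c with hL
  have hLn : ‖L‖ ≤ 2 * M / R := norm_fderiv_le_of_forall_mem_ball_norm_le hR hd hM
  set ψ : P → G := fun w => f w - L (w - c) with hψ
  have hψd : DifferentiableOn ℂ ψ (ball c R) :=
    hd.sub ((L.differentiable.comp (differentiable_id.sub_const c)).differentiableOn)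
  have hψc : ψ c = f c := by simp [hψ]
  have hmaps : MapsTo ψ (ball c R) (closedBall (ψ c) (4 * M)) := by
    intro w hw
    rw [mem_closedBall, dist_eq_norm, hψc]
    have hwc : ‖w - c‖ < R := by rwa [mem_ball, dist_eq_norm] at hw
    have e1 : ψ w - f c = (f w - f c) - L (w - c) := by simp only [hψ]; abel
    calc ‖ψ w - f c‖ = ‖(f w - f c) - L (w - c)‖ := by rw [e1]
      _ ≤ ‖f w - f c‖ + ‖L (w - c)‖ := norm_sub_le _ _
      _ ≤ (‖f w‖ + ‖f c‖) + ‖L‖ * ‖w - c‖ := add_le_add (norm_sub_le _ _) (L.le_opNorm _)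
      _ ≤ (M + M) + 2 * M / R * R := by
          have h1 : ‖f w‖ ≤ M := hM w hw
          have h2 : ‖f c‖ ≤ M := hM c (mem_ball_self hR)
          have h3 : ‖L‖ * ‖w - c‖ ≤ 2 * M / R * R :=
            calc ‖L‖ * ‖w - c‖ ≤ 2 * M / R * ‖w - c‖ := by gcongr
              _ ≤ 2 * M / R * R := by gcongr
          linarith
      _ = 4 * M := by field_simp; ring
  have hfd : HasFDerivAt f L c := (hd.differentiableAt (ball_mem_nhds c hR)).hasFDerivAt
  have hn : (fun w => ψ w - ψ c) =o[𝓝 c] fun w => ‖w - c‖ ^ 1 := by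
    have h1 : (fun w => ψ w - ψ c) = fun w => f w - f c - L (w - c) := by
      funext w; rw [hψc]; simp only [hψ]; abel
    rw [h1]
    exact hfd.isLittleO.trans_isBigO (by simpa using (isBigO_refl (fun w => w - c) (𝓝 c)).norm_right)
  have h := Complex.dist_le_mul_div_pow_of_mapsTo_ball_of_isLittleO hψd hmaps hn hz
  rw [dist_eq_norm, dist_eq_norm, hψc] at h
  have e : ψ z - f c = f z - f c - L (z - c) := by simp only [hψ]; abel
  rw [e] at h
  simpa [pow_succ] using h

end Schwarz

/-! ### Measurability of the derivative of a measurable family along a vector -/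

section Measurable

variable {α : Type*} [MeasurableSpace α] {μ : Measure α}

/-- **The directional derivative of a measurable holomorphic (or just differentiable) family is
a.e. strongly measurable**: if `F(p, ·)` is a.e. strongly measurable for every `p` in a ball around
`x₀` and `F(·, a)` is (complex) differentiable at `x₀` for a.e. `a`, then
`a ↦ D_pF(x₀, a) v` is a.e. strongly measurable — it is the a.e. limit of the difference
quotients `tₙ⁻¹ (F(x₀ + tₙ v, a) - F(x₀, a))`, `tₙ = R/((n+2)(‖v‖+1)) → 0`. [folklore] -/
theorem aestronglyMeasurable_fderiv_apply {F : P → α → G} {x₀ : P} {R : ℝ} (hR : 0 < R)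
    (hF_meas : ∀ p ∈ ball x₀ R, AEStronglyMeasurable (F p) μ)
    (hF_diff : ∀ᵐ a ∂μ, DifferentiableAt ℂ (fun p => F p a) x₀) (v : P) :
    AEStronglyMeasurable (fun a => fderiv ℂ (fun p => F p a) x₀ v) μ := by
  -- the sequence of increments
  set t : ℕ → ℝ := fun n => R / ((n + 2) * (‖v‖ + 1)) with ht
  have htpos : ∀ n, 0 < t n := fun n => by rw [ht]; positivity
  have htlt : ∀ n, ‖t n • v‖ < R := by
    intro n
    rw [norm_smul, Real.norm_of_nonneg (htpos n).le, ht]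
    have hv : ‖v‖ < ‖v‖ + 1 := lt_add_one _
    have h2 : (1 : ℝ) ≤ (n : ℝ) + 2 := by
      have : (0 : ℝ) ≤ n := Nat.cast_nonneg n
      linarith
    calc R / ((n + 2) * (‖v‖ + 1)) * ‖v‖ ≤ R / (1 * (‖v‖ + 1)) * ‖v‖ := by
          gcongr
      _ = R * (‖v‖ / (‖v‖ + 1)) := by ring
      _ < R * 1 := by
          gcongr
          rwa [div_lt_one (by positivity)]
      _ = R := mul_one R
  have htlim : Tendsto t atTop (𝓝 0) := by
    have h1 : Tendsto (fun n : ℕ => (1 : ℝ) / ((n : ℝ) + 2)) atTop (𝓝 0) := by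
      have := tendsto_one_div_add_atTop_nhds_zero_nat (𝕜 := ℝ)
      refine (this.comp (tendsto_add_atTop_nat 1)).congr fun n => ?_
      simp only [Function.comp_apply, Nat.cast_add, Nat.cast_one]
      ring_nf
    have h2 : t = fun n : ℕ => R / (‖v‖ + 1) * (1 / ((n : ℝ) + 2)) := by
      funext n; rw [ht]; field_simp
    rw [h2]
    simpa using h1.const_mul (R / (‖v‖ + 1))
  -- the difference quotients
  set g : ℕ → α → G := fun n a => (t n)⁻¹ • (F (x₀ + t n • v) a - F x₀ a) with hg
  have hgm : ∀ n, AEStronglyMeasurable (g n) μ := by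
    intro n
    have h1 : x₀ + t n • v ∈ ball x₀ R := by
      rw [mem_ball, dist_eq_norm, add_sub_cancel_left]; exact htlt n
    exact ((hF_meas _ h1).sub (hF_meas x₀ (mem_ball_self hR))).const_smul _
  refine aestronglyMeasurable_of_tendsto_ae atTop hgm ?_
  filter_upwards [hF_diff] with a ha
  -- the derivative along the real line `s ↦ x₀ + s • v`
  set φ : ℝ → G := fun s => F (x₀ + s • v) a with hφ
  have hline : HasDerivAt (fun s : ℝ => x₀ + s • v) v 0 := by
    simpa using ((hasDerivAt_id (0 : ℝ)).smul_const v).const_add x₀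
  have hφd : HasDerivAt φ (fderiv ℂ (fun p => F p a) x₀ v) 0 := by
    have h0 : x₀ + (0 : ℝ) • v = x₀ := by simp
    have h1 : HasFDerivAt (fun p => F p a)
        ((fderiv ℂ (fun p => F p a) x₀).restrictScalars ℝ) (x₀ + (0 : ℝ) • v) := by
      rw [h0]; exact ha.hasFDerivAt.restrictScalars ℝ
    have h2 := HasFDerivAt.comp_hasDerivAt (0 : ℝ) h1 hline
    simpa [hφ, Function.comp_def] using h2
  have hslope : Tendsto (slope φ 0) (𝓝[≠] 0) (𝓝 (fderiv ℂ (fun p => F p a) x₀ v)) :=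
    hasDerivAt_iff_tendsto_slope.1 hφd
  have ht' : Tendsto t atTop (𝓝[≠] 0) :=
    tendsto_nhdsWithin_of_tendsto_nhds_of_eventually_within _ htlim
      (Eventually.of_forall fun n => (htpos n).ne')
  have h := hslope.comp ht'
  refine h.congr fun n => ?_
  simp only [Function.comp_apply, slope_def_module, sub_zero, hg, hφ, zero_smul, add_zero]

end Measurable

/-! ### Differentiation under the integral sign for holomorphic families -/

section Integral

variable {α : Type*} [MeasurableSpace α] {μ : Measure α}

/-- **Holomorphic families may be differentiated under the integral sign, with no hypothesis on
the derivative.** Let `F : P → α → G`, `x₀ ∈ P`, `R > 0`. Assume: `F(p, ·)` is a.e. strongly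
measurable for every `p ∈ ball x₀ R`; for a.e. `a`, `F(·, a)` is complex differentiable on
`ball x₀ R`; and `‖F(p, a)‖ ≤ bound(a)` for all `p ∈ ball x₀ R`, a.e. in `a`, with `bound`
integrable. Then `p ↦ ∫ F(p, a) dμ` has at `x₀` the Fréchet derivative `v ↦ ∫ D_pF(x₀, a) v dμ`
(a continuous linear map of norm `≤ 2‖bound‖₁/R`). Proof: the candidate is linear and bounded by
Cauchy's estimate `‖D_pF(x₀,a)‖ ≤ 2 bound(a)/R`; the remainder
`∫ (F(x₀+h,a) - F(x₀,a) - D_pF(x₀,a)h) dμ` is bounded by `4‖bound‖₁(‖h‖/R)²` by the second-order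
Schwarz estimate under the integral sign. [folklore] -/
theorem hasFDerivAt_integral_of_dominated_of_differentiableOn {F : P → α → G} {x₀ : P} {R : ℝ}
    (hR : 0 < R) (hF_meas : ∀ p ∈ ball x₀ R, AEStronglyMeasurable (F p) μ)
    (hF_diff : ∀ᵐ a ∂μ, DifferentiableOn ℂ (fun p => F p a) (ball x₀ R))
    {bound : α → ℝ} (hbound : Integrable bound μ)
    (hF_bound : ∀ᵐ a ∂μ, ∀ p ∈ ball x₀ R, ‖F p a‖ ≤ bound a) :
    ∃ L : P →L[ℂ] G, (∀ v, L v = ∫ a, fderiv ℂ (fun p => F p a) x₀ v ∂μ) ∧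
      HasFDerivAt (fun p => ∫ a, F p a ∂μ) L x₀ := by
  have hx₀ : x₀ ∈ ball x₀ R := mem_ball_self hR
  have hdiffAt : ∀ᵐ a ∂μ, DifferentiableAt ℂ (fun p => F p a) x₀ := by
    filter_upwards [hF_diff] with a ha using ha.differentiableAt (ball_mem_nhds x₀ hR)
  -- integrability of the slices
  have hint : ∀ p ∈ ball x₀ R, Integrable (F p) μ := fun p hp =>
    hbound.mono' (hF_meas p hp) (by filter_upwards [hF_bound] with a ha using ha p hp)
  -- the candidate derivative: Cauchy's estimate under the integral sign
  set D : α → P →L[ℂ] G := fun a => fderiv ℂ (fun p => F p a) x₀ with hD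
  have hDbd : ∀ᵐ a ∂μ, ∀ v, ‖D a v‖ ≤ 2 * bound a / R * ‖v‖ := by
    filter_upwards [hF_diff, hF_bound] with a had hab v
    exact (D a).le_of_opNorm_le (norm_fderiv_le_of_forall_mem_ball_norm_le hR had hab) v
  have hDm : ∀ v, AEStronglyMeasurable (fun a => D a v) μ := fun v =>
    aestronglyMeasurable_fderiv_apply hR hF_meas hdiffAt v
  have hmaj : ∀ v : P, Integrable (fun a => 2 * bound a / R * ‖v‖) μ := fun v =>
    ((hbound.const_mul (2 / R)).mul_const ‖v‖).congr (Eventually.of_forall fun a => by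
      simp only; ring)
  have hDi : ∀ v, Integrable (fun a => D a v) μ := fun v =>
    (hmaj v).mono' (hDm v) (by filter_upwards [hDbd] with a ha using ha v)
  set Lₗ : P →ₗ[ℂ] G :=
    { toFun := fun v => ∫ a, D a v ∂μ
      map_add' := fun v w => by
        simp only [map_add]
        exact integral_add (hDi v) (hDi w)
      map_smul' := fun c v => by
        simp only [map_smul, RingHom.id_apply]
        exact integral_smul c _ } with hLₗ
  have hLbd : ∀ v, ‖Lₗ v‖ ≤ (2 / R * ∫ a, bound a ∂μ) * ‖v‖ := by
    intro v
    change ‖∫ a, D a v ∂μ‖ ≤ _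
    calc ‖∫ a, D a v ∂μ‖ ≤ ∫ a, 2 * bound a / R * ‖v‖ ∂μ :=
          norm_integral_le_of_norm_le (hmaj v) (by filter_upwards [hDbd] with a ha using ha v)
      _ = (2 / R * ∫ a, bound a ∂μ) * ‖v‖ := by
          rw [integral_mul_const, ← integral_const_mul]
          congr 1
          refine integral_congr_ae (Eventually.of_forall fun a => ?_)
          ring
  set L : P →L[ℂ] G := Lₗ.mkContinuous _ hLbd with hL
  have hLv : ∀ v, L v = ∫ a, D a v ∂μ := fun v => rfl
  refine ⟨L, hLv, ?_⟩
  -- the remainder estimate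
  rw [hasFDerivAt_iff_isLittleO_nhds_zero, isLittleO_iff]
  intro c hc
  set K : ℝ := 4 * (∫ a, bound a ∂μ) / R ^ 2 with hK
  have hK0 : 0 ≤ K := by
    have : 0 ≤ ∫ a, bound a ∂μ := integral_nonneg_of_ae (by
      filter_upwards [hF_bound] with a ha using (norm_nonneg _).trans (ha x₀ hx₀))
    positivity
  have hδ : ∀ᶠ h in 𝓝 (0 : P), ‖h‖ < R ∧ K * ‖h‖ ≤ c := by
    have h1 : ∀ᶠ h in 𝓝 (0 : P), ‖h‖ < R := by
      filter_upwards [ball_mem_nhds (0 : P) hR] with h hh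
      simpa using hh
    have h2 : ∀ᶠ h in 𝓝 (0 : P), ‖h‖ ≤ c / (K + 1) := by
      have : closedBall (0 : P) (c / (K + 1)) ∈ 𝓝 (0 : P) := closedBall_mem_nhds _ (by positivity)
      filter_upwards [this] with h hh
      simpa [dist_eq_norm] using hh
    filter_upwards [h1, h2] with h hh1 hh2
    refine ⟨hh1, ?_⟩
    calc K * ‖h‖ ≤ K * (c / (K + 1)) := by gcongr
      _ ≤ c := by
          rw [mul_div_assoc']
          rw [div_le_iff₀ (by positivity)]
          nlinarith
  filter_upwards [hδ] with h ⟨hhR, hhc⟩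
  have hmem : x₀ + h ∈ ball x₀ R := by rwa [mem_ball, dist_eq_norm, add_sub_cancel_left]
  -- pointwise second-order estimate
  have hpt : ∀ᵐ a ∂μ, ‖F (x₀ + h) a - F x₀ a - D a h‖ ≤ 4 * bound a * (‖h‖ / R) ^ 2 := by
    filter_upwards [hF_diff, hF_bound] with a had hab
    have := norm_sub_sub_fderiv_le_of_forall_mem_ball_norm_le had hab hmem
    simpa [hD, add_sub_cancel_left] using this
  have hsplit : (∫ a, F (x₀ + h) a ∂μ) - (∫ a, F x₀ a ∂μ) - L h =
      ∫ a, (F (x₀ + h) a - F x₀ a - D a h) ∂μ := by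
    rw [hLv, ← integral_sub (hint _ hmem) (hint _ hx₀),
      ← integral_sub ((hint _ hmem).sub' (hint _ hx₀)) (hDi h)]
  rw [hsplit]
  calc ‖∫ a, (F (x₀ + h) a - F x₀ a - D a h) ∂μ‖
      ≤ ∫ a, 4 * bound a * (‖h‖ / R) ^ 2 ∂μ :=
        norm_integral_le_of_norm_le ((hbound.const_mul 4).mul_const _) hpt
    _ = K * ‖h‖ * ‖h‖ := by
        rw [integral_mul_const, integral_const_mul, hK]
        field_simp
    _ ≤ c * ‖h‖ := by gcongr

/-- **Holomorphy of dominated parameter integrals** (`DifferentiableOn ℂ` form): on an open set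
`U ⊆ P`, if `F(p, ·)` is a.e. strongly measurable for `p ∈ U`, `F(·, a)` is holomorphic on `U`
for a.e. `a`, and every point of `U` has a ball in `U` on which `‖F(p, a)‖ ≤ bound(a)` with an
integrable `bound`, then `p ↦ ∫ F(p, a) dμ` is holomorphic on `U`. [folklore] -/
theorem differentiableOn_integral_of_dominated {F : P → α → G} {U : Set P}
    (hF_meas : ∀ p ∈ U, AEStronglyMeasurable (F p) μ)
    (hF_diff : ∀ᵐ a ∂μ, DifferentiableOn ℂ (fun p => F p a) U)
    (hF_dom : ∀ x₀ ∈ U, ∃ R : ℝ, 0 < R ∧ ball x₀ R ⊆ U ∧ ∃ bound : α → ℝ, Integrable bound μ ∧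
      ∀ᵐ a ∂μ, ∀ p ∈ ball x₀ R, ‖F p a‖ ≤ bound a) :
    DifferentiableOn ℂ (fun p => ∫ a, F p a ∂μ) U := by
  intro x₀ hx₀
  obtain ⟨R, hR, hRU, bound, hbound, hFb⟩ := hF_dom x₀ hx₀
  have hdiff : ∀ᵐ a ∂μ, DifferentiableOn ℂ (fun p => F p a) (ball x₀ R) := by
    filter_upwards [hF_diff] with a ha using ha.mono hRU
  obtain ⟨L, -, hL⟩ := hasFDerivAt_integral_of_dominated_of_differentiableOn hR
    (fun p hp => hF_meas p (hRU hp)) hdiff hbound hFb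
  exact hL.differentiableAt.differentiableWithinAt

end Integral

end Literature.Analysis.Complex

end
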